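import Literature.Geometry.Lorentzian.CorrespondingBoundaryTimelike
import HarnessLib

/-!
# Corresponding boundary points are limits of timelike curves (Sbierski 2016, Prop. 13)

Sequel to `Literature.Geometry.Lorentzian.CorrespondingBoundaryTimelike` (symmetry of corresponding
pairs, `ψ` carries `≪`, the strong-causality box, and Sbierski's first step
`ψ(I⁻(p) ∩ U) ⊆ I⁻(p')`). J. Sbierski, Ann. Henri Poincaré 17 (2016) 301–329 =
arXiv:1309.7591v3, §3.2, Proposition 13 (*"EquivCha"*), for a common globally hyperbolic
development `(U, ψ)` of the Cauchy developments `𝒟`, `𝒟'` and `p ∈ ∂U`, `p' ∈ ∂ψ(U)`: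

> *(i)* `p`, `p'` are corresponding boundary points *⇒ (ii)* if `γ : (−ε, 0) → U` is a timelike
> curve with `lim_{s ↗ 0} γ(s) = p`, then `lim_{s ↗ 0} (ψ ∘ γ)(s) = p'` … *(iii) ⇒ (i)* is trivial
> … *In particular `p ∈ ∂U` has at most one corresponding boundary point.*

* `CommonDevelopment.isCorrespondingPair_of_tendsto` — **(iii) ⇒ (i)** (pure topology: `ψ⁻¹` is
  continuous on the open set `ψ(U)`);
* `CommonDevelopment.IsCorrespondingPair.tendsto_glue` — **(i) ⇒ (ii)** for `p'` to the future of
  `ι'(X)`, with the global-hyperbolicity consequences used by the printed proof DISPLAYED as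
  hypotheses in their weakest used form (closed causal futures of points in `M` and `M'`, strong
  causality of `M'`; they are not yet theorems over the tree's Cauchy developments);
* `CommonDevelopment.IsCorrespondingPair.eq_of_mem_chronologicalFuture` — **at most one
  corresponding boundary point** (future case), the curve of (iii) being supplied by a timelike
  segment from a point `x ≪ p` of `U` close to `p`.

Everything is proved; no definitions, no named facts (D-0026).

## References

* J. Sbierski, Ann. Henri Poincaré 17 (2016) 301–329 = arXiv:1309.7591v3, §3.2, Def. 11 and
  Prop. 13 with its proof and footnotes (arXiv numbering). [Sbierski2016AHP]
* B. O'Neill, *Semi-Riemannian geometry with applications to relativity*, Academic Press 1983,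
  Ch. 14, Lemma 14.3, Cor. 14.1, Lemma 14.22, p. 437 (strong causality). [ONeillSemiRiemannian1983]
-/

noncomputable section

open Bundle Set Function Filter TopologicalSpace Topology Manifold
open scoped Manifold ContDiff Topology

namespace Literature.Geometry.Lorentzian

universe u

section Developments

variable {k : ℕ} {X : Type u} [TopologicalSpace X] [ChartedSpace (EuclideanSpace ℝ (Fin k)) X]
  [IsManifold (𝓡 k) ∞ X] [ConnectedSpace X] {D : InitialDataSet (𝓡 k) X}

namespace CauchyDevelopment.CommonDevelopment

variable {𝒟 𝒟' : CauchyDevelopment D} (𝔠 : CommonDevelopment 𝒟 𝒟')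

/-- **Sbierski 2016, Prop. 13, (iii) ⇒ (i)**: if some curve `γ` of `U` converges to the
boundary point `p ∈ ∂U` while `ψ ∘ γ` converges to `p'`, then `p` and `p'` are corresponding
boundary points. The neighbourhood clause of Def. 11 is immediate; `p' ∈ ∂ψ(U)` because
`p' ∈ closure ψ(U)`, and `p' = ψ y₀ ∈ ψ(U)` would force `γ = ψ⁻¹ ∘ (ψ ∘ γ) → y₀ ∈ U` (continuity
of `ψ⁻¹` on the open set `ψ(U)`), i.e. `p = y₀ ∈ U`, impossible for a boundary point of the open
set `U`. (No causality is needed; the printed "trivial".) [cite: Sbierski2016AHP, §3.2, Prop. 13 (iii) ⇒ (i) (arXiv numbering)] -/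
theorem isCorrespondingPair_of_tendsto {p : 𝒟.carrier} {p' : 𝒟'.carrier}
    (hp : p ∈ frontier (𝔠.opens : Set 𝒟.carrier)) {l : Filter ℝ} [l.NeBot] {γ : ℝ → 𝒟.carrier}
    (hγU : ∀ᶠ t in l, γ t ∈ 𝔠.opens) (hlim : Tendsto γ l (𝓝 p))
    (hlim' : Tendsto (𝔠.glue ∘ γ) l (𝓝 p')) : 𝔠.IsCorrespondingPair p p' := by
  have hpU : p ∉ 𝔠.opens := fun h ↦ by
    have := 𝔠.opens.2.inter_frontier_eq
    exact (eq_empty_iff_forall_notMem.1 this) p ⟨h, hp⟩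
  refine ⟨hp, ?_, fun V hV V' hV' ↦ ?_⟩
  · -- `p' ∈ closure ψ(U) ∖ ψ(U)`
    have hcl : p' ∈ closure (range 𝔠.map) := by
      refine mem_closure_of_tendsto hlim' ?_
      filter_upwards [hγU] with t ht
      rw [comp_apply, 𝔠.glue_apply ht]
      exact ⟨_, rfl⟩
    have hnot : p' ∉ range 𝔠.map := by
      rintro ⟨y₀, hy₀⟩
      -- `γ = ψ⁻¹ ∘ (ψ ∘ γ) → ψ⁻¹ p' = y₀`
      have hsymm : ContinuousAt 𝔠.glue.symm p' :=
        (𝔠.contMDiffAt_glue_symm ⟨y₀, hy₀⟩).continuousAt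
      have h1 : Tendsto (𝔠.glue.symm ∘ (𝔠.glue ∘ γ)) l (𝓝 (𝔠.glue.symm p')) :=
        hsymm.tendsto.comp hlim'
      have h2 : (𝔠.glue.symm ∘ (𝔠.glue ∘ γ)) =ᶠ[l] γ := by
        filter_upwards [hγU] with t ht
        exact 𝔠.glue.left_inv (by rw [glue_source]; exact ht)
      have h3 : Tendsto γ l (𝓝 (𝔠.glue.symm p')) := h1.congr' h2
      have h4 : p = 𝔠.glue.symm p' := tendsto_nhds_unique hlim h3
      rw [← hy₀, 𝔠.glue_symm_apply_map] at h4
      exact hpU (h4 ▸ y₀.2)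
    rw [(𝔠.isOpenEmbedding_map.isOpen_range).frontier_eq]   -- hmm: frontier of open set = closure \ set
    exact ⟨hcl, hnot⟩
  · have h1 : ∀ᶠ t in l, γ t ∈ V := hlim hV
    have h2 : ∀ᶠ t in l, (𝔠.glue ∘ γ) t ∈ V' := hlim' hV'
    obtain ⟨t, htU, htV, htV'⟩ := (hγU.and (h1.and h2)).exists
    refine ⟨⟨γ t, htU⟩, htV, ?_⟩
    rw [comp_apply, 𝔠.glue_apply htU] at htV'
    exact htV'

variable {𝔠}

/-- **Sbierski 2016, Prop. 13, (i) ⇒ (ii)** (for `p'` to the future of `ι'(X)`). Let `(U, ψ)` be a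
common globally hyperbolic development of the Cauchy developments `𝒟`, `𝒟'`, assume the causal
futures of points are closed in `M` and in `M'` and `M'` is strongly causal (all consequences of
global hyperbolicity), and let `p ∈ ∂U`, `p' ∈ ∂ψ(U) ∩ I⁺(ι'(X))` be corresponding boundary
points. Then for every future timelike curve `γ : [a, b) → U` of `M` with `γ t → p` as `t ↑ b`,
`ψ(γ t) → p'`. Proof as printed: given `V' ∋ p'`, strong causality provides `W' ∋ p'` with
`I⁺(q') ∩ I⁻(p') ⊆ V'` for `q' ∈ W'`; a point `q' ∈ W'` with `q' ≪ p'` lies in `ψ(U)` (no timelike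
entry into `ψ(U)` from `J⁺(ι'X) ∖ ψ(U)`, applied to `𝔠.symm`), and `q := ψ⁻¹ q' ≪ p` (the first step
for the symmetric pair); eventually `q ≪ γ t ≪ p`, whence `q' ≪ ψ(γ t) ≪ p'` (the first step
again), i.e. `ψ(γ t) ∈ V'`. [cite: Sbierski2016AHP, §3.2, Prop. 13 (i) ⇒ (ii) (arXiv numbering)] -/
theorem IsCorrespondingPair.tendsto_glue
    (hJ : ∀ x : 𝒟.carrier, IsClosed (𝒟.metric.causalFuture 𝒟.timeOrientation {x}))
    (hJ' : ∀ x' : 𝒟'.carrier, IsClosed (𝒟'.metric.causalFuture 𝒟'.timeOrientation {x'}))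
    (hSC' : 𝒟'.metric.IsStronglyCausal 𝒟'.timeOrientation)
    {p : 𝒟.carrier} {p' : 𝒟'.carrier} (h : 𝔠.IsCorrespondingPair p p')
    (hp' : p' ∈ 𝒟'.metric.chronologicalFuture 𝒟'.timeOrientation (range 𝒟'.embed))
    {γ : ℝ → 𝒟.carrier} {a b : ℝ} (hab : a < b)
    (hγ : 𝒟.metric.IsFutureTimelikeCurveOn 𝒟.timeOrientation γ (Ico a b))
    (hγU : ∀ t ∈ Ico a b, γ t ∈ 𝔠.opens) (hlim : Tendsto γ (𝓝[<] b) (𝓝 p)) :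
    Tendsto (𝔠.glue ∘ γ) (𝓝[<] b) (𝓝 p') := by
  have hn2 : (2 : ℕ∞ω) ≤ ∞ := WithTop.coe_le_coe.mpr le_top
  have hn1 : (1 : ℕ∞ω) ≤ ∞ := le_trans one_le_two hn2
  set g := 𝒟.metric with hg
  set τ := 𝒟.timeOrientation with hτ
  set g' := 𝒟'.metric with hg'
  set τ' := 𝒟'.timeOrientation with hτ'
  -- (a) `γ t ≪ p` for every `t`
  have hγp : ∀ t ∈ Ico a b, p ∈ g.chronologicalFuture τ {γ t} := by
    intro t ht
    set t₁ : ℝ := (t + b) / 2 with ht₁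
    have htt₁ : t < t₁ := by rw [ht₁]; linarith [ht.2]
    have ht₁b : t₁ < b := by rw [ht₁]; linarith [ht.2]
    have h1 : γ t₁ ∈ g.chronologicalFuture τ {γ t} :=
      ⟨γ t, rfl, γ, t, t₁, htt₁, hγ.mono (Icc_subset_Ico_right ht₁b |>.trans
        (Ico_subset_Ico_left ht.1)), rfl, rfl⟩
    -- `p ∈ closure I⁺(γ t₁) ⊆ J⁺(γ t₁)`
    have h2 : p ∈ g.causalFuture τ {γ t₁} := by
      refine (hJ _).closure_subset_iff.2
        (LorentzianMetric.chronologicalFuture_subset_causalFuture _ _ _) ?_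
      refine mem_closure_of_tendsto hlim ?_
      filter_upwards [Ioo_mem_nhdsLT ht₁b] with t₂ ht₂
      exact ⟨γ t₁, rfl, γ, t₁, t₂, ht₂.1, hγ.mono ((Icc_subset_Ico_right ht₂.2).trans
        (Ico_subset_Ico_left (ht.1.trans htt₁.le))), rfl, rfl⟩
    exact LorentzianMetric.mem_chronologicalFuture_of_mem_chronologicalFuture_of_mem_causalFuture
      hn1 h1 h2
  -- (b) the strong-causality box and a point `q' ≪ p'` of `ψ(U)` in it
  rw [tendsto_def]
  intro V' hV'
  obtain ⟨W', hW', hW'V', hbox⟩ := hSC'.exists_nhds_chronologicalDiamond_subset p' hV'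
  have hA' : g'.IsAchronal τ' (range 𝒟'.embed) :=
    LorentzianMetric.IsCauchyHypersurface.isAchronal_holds hn2 𝒟'.isCauchyHypersurface
  obtain ⟨q', ⟨hq'W, hq'I⟩, hq'p⟩ : ((W' ∩ g'.chronologicalFuture τ' (range 𝒟'.embed)) ∩
      g'.chronologicalPast τ' {p'}).Nonempty := by
    have hnhds : W' ∩ g'.chronologicalFuture τ' (range 𝒟'.embed) ∈ 𝓝 p' :=
      inter_mem hW' ((LorentzianMetric.isOpen_chronologicalFuture_of_boundaryless _ _ _).mem_nhds hp')
    have hcl : p' ∈ closure (g'.chronologicalPast τ' {p'}) :=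
      LorentzianMetric.subset_closure_chronologicalFuture (g := g') (τ := τ'.reverse) {p'} rfl
    exact mem_closure_iff_nhds.1 hcl _ hnhds
  have hp'q : p' ∈ g'.chronologicalFuture τ' {q'} :=
    LorentzianMetric.mem_chronologicalFuture_of_mem_chronologicalPast hq'p
  -- `q' ∈ ψ(U)`: no timelike entry into `ψ(U)` from `J⁺(ι'X)`, for `𝔠.symm`
  have hq'U : q' ∈ 𝔠.rangeOpens :=
    hA'.mem_opens_of_mem_closure_of_mem_chronologicalFuture hn2 _ _ 𝔠.symm.isCauchyHypersurface
      (LorentzianMetric.chronologicalFuture_subset_causalFuture _ _ _ hq'I)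
      (frontier_subset_closure h.2.1) hp'q
  -- (c) `q := ψ⁻¹ q' ≪ p`, by the first step for the symmetric pair
  set z : 𝔠.rangeOpens := ⟨q', hq'U⟩ with hz
  have hqp : p ∈ g.chronologicalFuture τ {𝔠.symmMap z} :=
    h.symm.mem_chronologicalFuture_map hJ (q := z) hp'q
  have hqU : 𝔠.symmMap z ∈ 𝔠.opens := 𝔠.symmMap_mem z
  have hmapq : 𝔠.map ⟨𝔠.symmMap z, hqU⟩ = q' := 𝔠.map_symmMap z
  -- (d) eventually `q ≪ γ t`, and then `ψ(γ t) ∈ I⁺(q') ∩ I⁻(p') ⊆ V'`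
  have hev : ∀ᶠ t in 𝓝[<] b, γ t ∈ g.chronologicalFuture τ {𝔠.symmMap z} :=
    hlim ((LorentzianMetric.isOpen_chronologicalFuture_of_boundaryless _ _ _).mem_nhds hqp)
  filter_upwards [hev, Ico_mem_nhdsLT hab] with t hqt ht
  set y : 𝔠.opens := ⟨γ t, hγU t ht⟩ with hy
  have h1 : 𝔠.map y ∈ g'.chronologicalFuture τ' {q'} := by
    rw [← hmapq]
    exact 𝔠.map_mem_chronologicalFuture_map hqt
  have h2 : p' ∈ g'.chronologicalFuture τ' {𝔠.map y} := h.mem_chronologicalFuture_map hJ' (hγp t ht)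
  have hmem : 𝔠.map y ∈ V' :=
    hbox q' hq'W ⟨h1, LorentzianMetric.mem_chronologicalPast_of_mem_chronologicalFuture h2⟩
  show t ∈ (𝔠.glue ∘ γ) ⁻¹' V'
  rw [mem_preimage, comp_apply, 𝔠.glue_apply (hγU t ht)]
  exact hmem

/-- **A boundary point has at most one corresponding boundary point** (Sbierski 2016, after
Prop. 13: "it follows from (ii) and (iii) that `p ∈ ∂U` has at most one corresponding boundary
point"), for boundary points to the future of the data hypersurfaces: both candidates are the
limit of `ψ ∘ γ` for one timelike curve `γ` of `U` approaching `p` (`tendsto_glue`); such a curve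
exists — a timelike segment from a point `x ≪ p` of `I⁺(ι(X))` close to `p` (which lies in `U`)
runs in `I⁺(x) ∩ I⁻(p) ⊆ U`. [cite: Sbierski2016AHP, §3.2, Prop. 13 and the remark after it (arXiv numbering)] -/
theorem IsCorrespondingPair.eq_of_mem_chronologicalFuture
    (hJ : ∀ x : 𝒟.carrier, IsClosed (𝒟.metric.causalFuture 𝒟.timeOrientation {x}))
    (hJ' : ∀ x' : 𝒟'.carrier, IsClosed (𝒟'.metric.causalFuture 𝒟'.timeOrientation {x'}))
    (hSC' : 𝒟'.metric.IsStronglyCausal 𝒟'.timeOrientation)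
    {p : 𝒟.carrier} {p' p'' : 𝒟'.carrier} (h' : 𝔠.IsCorrespondingPair p p')
    (h'' : 𝔠.IsCorrespondingPair p p'')
    (hp : p ∈ 𝒟.metric.chronologicalFuture 𝒟.timeOrientation (range 𝒟.embed))
    (hp' : p' ∈ 𝒟'.metric.chronologicalFuture 𝒟'.timeOrientation (range 𝒟'.embed))
    (hp'' : p'' ∈ 𝒟'.metric.chronologicalFuture 𝒟'.timeOrientation (range 𝒟'.embed)) :
    p' = p'' := by
  have hn2 : (2 : ℕ∞ω) ≤ ∞ := WithTop.coe_le_coe.mpr le_top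
  set g := 𝒟.metric with hg
  set τ := 𝒟.timeOrientation with hτ
  -- a point `x ≪ p` of `U`
  have hA : g.IsAchronal τ (range 𝒟.embed) :=
    LorentzianMetric.IsCauchyHypersurface.isAchronal_holds hn2 𝒟.isCauchyHypersurface
  obtain ⟨x, hxI, hxp⟩ : (g.chronologicalFuture τ (range 𝒟.embed) ∩
      g.chronologicalPast τ {p}).Nonempty :=
    mem_closure_iff_nhds.1
      (LorentzianMetric.subset_closure_chronologicalFuture (g := g) (τ := τ.reverse) {p} rfl) _
      ((LorentzianMetric.isOpen_chronologicalFuture_of_boundaryless _ _ _).mem_nhds hp)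
  have hpx : p ∈ g.chronologicalFuture τ {x} :=
    LorentzianMetric.mem_chronologicalFuture_of_mem_chronologicalPast hxp
  have hxU : x ∈ 𝔠.opens :=
    hA.mem_opens_of_mem_closure_of_mem_chronologicalFuture hn2 _ _ 𝔠.isCauchyHypersurface
      (LorentzianMetric.chronologicalFuture_subset_causalFuture _ _ _ hxI)
      (frontier_subset_closure h'.1) hpx
  -- the timelike segment from `x` to `p`, inside `U` before `p`
  obtain ⟨x₀, hx₀, γ, a, b, hab, hγ, hγa, hγb⟩ := hpx
  rw [mem_singleton_iff] at hx₀
  subst hx₀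
  have hγU : ∀ t ∈ Ico a b, γ t ∈ 𝔠.opens := by
    intro t ht
    rcases eq_or_lt_of_le ht.1 with hat | hat
    · rw [← hat, hγa]; exact hxU
    · refine 𝒟.isCauchyHypersurface.chronologicalFuture_inter_chronologicalPast_subset_opens hn2 _ _
        𝔠.isCauchyHypersurface (q := γ a) (p := γ b) (by rw [hγa]; exact hxU)
        (by rw [hγb]; exact frontier_subset_closure h'.1) ⟨?_, ?_⟩
      · exact ⟨γ a, rfl, γ, a, t, hat, hγ.mono (Icc_subset_Icc_right ht.2.le), rfl, rfl⟩
      · exact LorentzianMetric.mem_chronologicalPast_of_mem_chronologicalFuture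
          ⟨γ t, rfl, γ, t, b, ht.2, hγ.mono (Icc_subset_Icc_left ht.1), rfl, rfl⟩
  have hlim : Tendsto γ (𝓝[<] b) (𝓝 p) := by
    rw [← hγb]
    exact ((hγ b (right_mem_Icc.2 hab.le)).1.continuousAt.continuousWithinAt).tendsto
  have hγ' : g.IsFutureTimelikeCurveOn τ γ (Ico a b) := hγ.mono Ico_subset_Icc_self
  exact tendsto_nhds_unique (h'.tendsto_glue hJ hJ' hSC' hp' hab hγ' hγU hlim)
    (h''.tendsto_glue hJ hJ' hSC' hp'' hab hγ' hγU hlim)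

end CauchyDevelopment.CommonDevelopment

end Developments

end Literature.Geometry.Lorentzian

end
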